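/-
Copyright (c) 2026 the pub-hodgecm-mathlib formalisation cell (harness21).  Prover seat hodgecm-mathlib-K2E4-p15 (g0), Track B ∕ K2-LIT
(build stream 29), h413 = `stmt-HodgeConjecture-24833`, line `K2_E4_SingularTransferKappaSign`, socket module «SingularProductFormula» (U2), file #15 — the payment of
`K2E4SingularTransferKappaSign.SingularProductFormula.sig_K2E4ExplicitSingularPairNondegenerate` TOKEN FOR TOKEN.  2026-09-03.
-/
import Literature.NumberTheory.Rogawski1990.TamagawaSingularMembersFinTFCovol   -- ★ the letters' FRAME and κ-block vocabulary (`CanonicalTransferMatrix`, `ArchCanonicalSingularMatrix`, …) — socket frame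
import Literature.NumberTheory.Weil1982.UnitaryFinCentralizerTopFormHaar         -- ★ socket frame import (kept verbatim so the auto-bound binders elaborate identically)
import Literature.NumberTheory.Rogawski1990.FinExplicitTransferFactorConjLeft     -- ★ `finExplicitDelta_conj_left_all`  (the explicit collection `Δ‴`)
import Literature.NumberTheory.Rogawski1990.FinExplicitTransferFactorConjRight    -- ★ `finExplicitDelta_conj_right_all`
import Literature.NumberTheory.Rogawski1990.ArchCanonicalTransferFactor           -- ★ `archCanonicalTransferFactor` = `Δ‴_∞ = c(H′)·Δ″_∞`
import Literature.NumberTheory.Rogawski1990.ExplicitFactorProductFormula          -- ★ socket frame import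
import Literature.NumberTheory.Automorphic.QuadraticHeckeCharacterCM              -- ★ `quadraticHeckeCharCM` (the μ-GUARD binder)
import Literature.NumberTheory.Rogawski1990.FinExplicitTransferFactorGHRegular    -- ★ (P-β) `finExplicitDelta_rationalComponent_ne_zero_of_eval_ne_zero` (`Δ‴_v ≠ 0` under `χ_g(u) ≠ 0`)
import Literature.NumberTheory.Rogawski1990.ExplicitFactorProductFormulaGHRegularArch   -- ★ (P-γ) `archCanonicalDelta_rationalArch_ne_zero_of_eval_ne_zero` (`Δ‴_∞ ≠ 0` under `χ_g(u) ≠ 0`)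
import Literature.NumberTheory.Rogawski1990.FinExplicitTransferFactorScalarPartner -- ★ `eval_charpoly_ne_zero_iff_of_fst_eq_smul_one_rational` (`χ_g(u) ≠ 0 ↔ e₂ ≠ e₁` at the scalar partner)
import Literature.NumberTheory.Rogawski1990.ArchSplitRationalWallTorusPoint       -- ★ `exists_eq_conj_diagonal_of_charpoly` (`γ₀ = Q·diag(e₁,e₂,e₁)·Q⁻¹`)
import Literature.NumberTheory.Rogawski1990.AdelicStableClassesProductGp          -- ★ `isLocalNormPair_rationalComponent_toLocal_toAdelic` (a rational `γ_H → γ` localises)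
import HarnessLib

/-!
# h413 ∕ Track B «K2-LIT», line `K2_E4_SingularTransferKappaSign`, socket module «SingularProductFormula» (U2): THE EXPLICIT FACTORS DO NOT VANISH AT THE SEMIREGULAR PAIR
# (payment of `Cruxes/H413/Lines/K2_E4_SingularTransferKappaSignSigsSingularProductFormula.lean :: sig_K2E4ExplicitSingularPairNondegenerate`, statement bytes frozen)

Cell `pub/hodgecm-mathlib`, crux H413 = `stmt-HodgeConjecture-24833`, route of record `HCCMUnconditional`; chair K2-lead (g0), dealer K2E4-plan (g0),
EMIT «SKELETON LANDED K2E4» (REQUESTS l.72384) file #15 `sig_K2E4ExplicitSingularPairNondegenerate` (M ①, FIRST RUNG) ↦ seat K2E4-p15.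
THEOREMS ONLY (no `def`, no `instance`, no `notation`, no named-fact hypothesis, no `sorry`); imports = ★ Literature + HarnessLib;
lane `--supports stmt-HodgeConjecture-24833 --as helper` (count-neutral: one socket of the line's U2 unit; it does not move 24833 by itself).

THE STATEMENT (bytes of the socket, under the letters' uniform FRAME of ★ `SingularEllipticTransfer` ∕ p844690, copied byte for byte as section variables).
For the PINNED explicit data `Δ = Δ‴ := finExplicitCollection L H′ μ …`, `Tinf = Δ‴_∞ := archCanonicalTransferFactor L H′ μ` and print's semiregular pair —
`γ₀ ∈ U(H′)(L⁺)` non-central with `(γ₀ − e₁)(γ₀ − e₂) = 0`, `e₁ ≠ e₂`, `charpoly γ₀ = (X − e₁)²(X − e₂)`, and `γ_H = (e₁·1₂, e₂) ∈ H(L⁺) = U(Φ₂) × U(Φ₁)` —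
`Δ‴_v((γ_H)_v, (γ₀)_v) ≠ 0` at EVERY finite place `v` of `L⁺`, and `Δ‴_∞(γ_H ⊗ 1, γ₀ ⊗ 1) ≠ 0`.

THE MATHEMATICS [Rogawski1990 §4.9 p. 55; Prop. 8.2.1 proof p. 119 «`τ(γ)|A₁(γ)A₂(γ)|`»].  `Δ‴ = τ · D_{G∕H} · κ` on matching pairs.  At the scalar partner
`γ_H = (e₁·1₂, e₂)`: `χ_g = (X − e₁)²`, so `χ_g(u) = (e₂ − e₁)² ≠ 0` — the pair is `(G,H)`-REGULAR though `G`-SINGULAR (★ `eval_charpoly_ne_zero_iff_of_fst_eq_smul_one_rational`);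
and `γ_H → γ₀` (★ `IsNormPair`: `ι(γ_H) = diag(e₁, e₂, e₁)` is `GL₃(L)`-conjugate to `γ₀ = Q · diag(e₁, e₂, e₁) · Q⁻¹`, ★ `exists_eq_conj_diagonal_of_charpoly` for `H′`
hermitian anisotropic).  A rational matching pair localises at every place (★ `isLocalNormPair_rationalComponent_toLocal_toAdelic`, ★
`isArchNormPair_rationalArch_cmRationalToArch`), and at a `(G,H)`-regular matching pair every factor of `Δ‴_v` ∕ `Δ‴_∞` is non-zero: ★ (P-β)
`finExplicitDelta_rationalComponent_ne_zero_of_eval_ne_zero` (`τ_v`, `D_v` at units; `κ_v = ±1` since `tr P_v = χ_g(u)` is a unit) and ★ (P-γ)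
`archCanonicalDelta_rationalArch_ne_zero_of_eval_ne_zero` (`κ‴_w` = a Hilbert symbol of a global `x ≠ 0`, uses `hherm`, `hanis`).

STRATEGY (Mathlib∕★ reuse first; differentiates from a from-scratch eigenline computation): (1) `IsNormPair L H′ γ_H γ₀` by the explicit conjugator `Q`
(§1 `isNormPair_of_scalarPartner`); (2) `χ_g(u) ≠ 0` from `e₁ ≠ e₂`; (3) substitute the pins `hΔ`, `hTinf` (★ `finExplicitCollection_Δ`, ★ `archCanonicalTransferFactor_Δ` are
`rfl`) and close with (P-β) ∕ (P-γ).  The measure-theoretic binders of the frame (`hK`, `Sbad`, `mH`, …, `hCTM`, `hACS`, `hμu`, `hμω`) are not read: the claim is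
about the VALUES of the pinned factors at one rational pair.

* §1 `isNormPair_of_scalarPartner`        · `γ_H = (e₁·1₂, e₂) → γ₀` for the semiregular `γ₀` (frame-free; reusable by sockets #16, #17 and dealer pool H2);
* §2 **`ExplicitSingularPairNondegenerate`** · `sig_K2E4ExplicitSingularPairNondegenerate` TOKEN FOR TOKEN (tie probe
      `example : type_of% @ExplicitSingularPairNondegenerate = type_of% @K2E4SingularTransferKappaSign.SingularProductFormula.sig_K2E4ExplicitSingularPairNondegenerate := rfl`
      at home once the socket module is built on stream 29: `K2/K2E4-p15/g0/Probe_K2E4ExplicitSingularPairNondegenerate.lean`).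

WHAT IS NOT HERE.  The a.e.-`= 1` statement (#16), the product formula at the pair (#17), the κ-sign (#14), Kottwitz parity (#18); any transfer statement.

HONEST LABEL.  HC_CM is proved only modulo the 7 printed citations (2 remaining named inputs: hLiu418 = `stmt-HodgeConjecture-24832`, h413 =
`stmt-HodgeConjecture-24833`) until rung 0 closes; this file moves no counter.

EDITION LOG.  ED. 1 ★ p854779.  ED. 2 (this text): docstring-only page fold per lit1 (5152) («§3.8 Prop. 3.8.1 p. 27» → pp. 30–31); Lean content byte-identical.

## References
* [Rogawski1990] J. D. Rogawski, *Automorphic Representations of Unitary Groups in Three Variables*, Ann. of Math. Stud. 123 (1990): §4.9 p. 55 (`τ`, `D_{G∕H}`,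
  `Δ_{G∕H} = τ D_{G∕H}`), §8.2 Prop. 8.2.1 pp. 117–119 (the singular `γ₀ ∈ M`, «`τ(γ)|A₁(γ)A₂(γ)|`»), §14.6 p. 242 («`κ(γ, ψ_v(i(γ)))` is equal to `±1`»), §3.8 Prop. 3.8.1 pp. 30–31.
* [LanglandsShelstad1987] R. P. Langlands, D. Shelstad, *On the definition of transfer factors*, Math. Ann. 278 (1987), §1–§2.
-/

set_option autoImplicit false
-- the mandated namespace repeats the single-problem summit's segment (`HodgeConjecture.HodgeConjecture`)
set_option linter.dupNamespace false

noncomputable section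

open MeasureTheory Measure NumberField IsDedekindDomain
open Literature.MeasureTheory.Group Literature.MeasureTheory.RestrictedProduct
open Literature.Topology.RestrictedProduct Literature.Topology.Algebra.RestrictedProduct
open Literature.NumberTheory.Rogawski1990 Literature.NumberTheory.Automorphic
open Literature.AlgebraicGeometry.ShimuraVarieties (unitaryGroup hermForm)
open scoped Matrix MatrixGroups RestrictedProduct

namespace Summit.HodgeConjecture.HodgeConjecture.Cruxes.H413.K2E4ExplicitSingularPairNondegenerate

/-! ## §1 The semiregular pair matches: `γ_H = (e₁·1₂, e₂) → γ₀` -/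

section NormPair

variable (L : Type) [Field L] [NumberField L] [IsCMField L] (H' : Matrix (Fin 3) (Fin 3) L)

/-- **`γ_H = (e₁·1₂, e₂) → γ₀` for print's semiregular `γ₀`.**  For `H′` hermitian anisotropic and `γ₀ ∈ U(H′)(L⁺)` non-central with `(γ₀ − e₁)(γ₀ − e₂) = 0`,
`e₁ ≠ e₂`, `charpoly γ₀ = (X − e₁)²(X − e₂)`: `γ₀ = Q · diag(e₁, e₂, e₁) · Q⁻¹` in `GL₃(L)` (★ `exists_eq_conj_diagonal_of_charpoly`), and `ι(e₁·1₂, e₂)` IS the matrix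
`diag(e₁, e₂, e₁)` (★ `coe_endoGL_eq`: the `U(Φ₂)`-block on `e₁, e₃`, the `U(Φ₁)`-entry on `e₂`), so `ι(γ_H)` and `γ₀` are `GL₃(L)`-conjugate — ★ `IsNormPair`
(`isNormPair_iff_isConj`).  [cite: Rogawski1990, §3.8 Prop. 3.8.1 pp. 30–31; §4.9 p. 54; §8.2 p. 117] -/
theorem isNormPair_of_scalarPartner (hherm : (H'.map (cmConjRingHom L)).transpose = H')
    (hanis : ∀ x : Fin 3 → L, hermForm (cmConjRingHom L) H' x x = 0 → x = 0)
    (γ₀ : (UnitaryGroup.cmDatum L 3 H').Rational) {e₁ e₂ : L} (he : e₁ ≠ e₂)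
    (hsplit : ((((γ₀ : unitaryGroup (cmConjRingHom L) H').val : GL (Fin 3) L) : Matrix (Fin 3) (Fin 3) L) - e₁ • (1 : Matrix (Fin 3) (Fin 3) L)) *
      ((((γ₀ : unitaryGroup (cmConjRingHom L) H').val : GL (Fin 3) L) : Matrix (Fin 3) (Fin 3) L) - e₂ • (1 : Matrix (Fin 3) (Fin 3) L)) = 0)
    (hnc : ¬ ∃ ζ : L, (((γ₀ : unitaryGroup (cmConjRingHom L) H').val : GL (Fin 3) L) : Matrix (Fin 3) (Fin 3) L) = ζ • (1 : Matrix (Fin 3) (Fin 3) L))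
    (hχ : (((γ₀ : unitaryGroup (cmConjRingHom L) H').val : GL (Fin 3) L) : Matrix (Fin 3) (Fin 3) L).charpoly =
      (Polynomial.X - Polynomial.C e₁) ^ 2 * (Polynomial.X - Polynomial.C e₂))
    (γH : (UnitaryGroup.cmDatum L 2 (Matrix.of fun i j : Fin 2 => if i.val + j.val + 1 = 2 then (1 : L) else 0)).Rational ×
      (UnitaryGroup.cmDatum L 1 (Matrix.of fun i j : Fin 1 => if i.val + j.val + 1 = 1 then (1 : L) else 0)).Rational)
    (h1 : (((γH.1 : unitaryGroup (cmConjRingHom L) (Matrix.of fun i j : Fin 2 => if i.val + j.val + 1 = 2 then (1 : L) else 0)).val : GL (Fin 2) L) :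
        Matrix (Fin 2) (Fin 2) L) = e₁ • (1 : Matrix (Fin 2) (Fin 2) L))
    (h2 : (((γH.2 : unitaryGroup (cmConjRingHom L) (Matrix.of fun i j : Fin 1 => if i.val + j.val + 1 = 1 then (1 : L) else 0)).val : GL (Fin 1) L) :
        Matrix (Fin 1) (Fin 1) L) 0 0 = e₂) :
    IsNormPair L H' γH γ₀ := by
  obtain ⟨Q, -, -, hQ⟩ := exists_eq_conj_diagonal_of_charpoly L H' hherm hanis (γ₀ : unitaryGroup (cmConjRingHom L) H') he hsplit hnc hχ
  -- `ι(γ_H)` is the diagonal matrix `diag(e₁, e₂, e₁)`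
  have hι : (((endoEmbRational L γH).val : GL (Fin 3) L) : Matrix (Fin 3) (Fin 3) L) = Matrix.diagonal ![e₁, e₂, e₁] := by
    rw [coe_endoEmbRational, coe_endoGL_eq]
    have h00 : (((γH.1 : unitaryGroup (cmConjRingHom L) (Matrix.of fun i j : Fin 2 => if i.val + j.val + 1 = 2 then (1 : L) else 0)).val : GL (Fin 2) L) :
        Matrix (Fin 2) (Fin 2) L) 0 0 = e₁ := by rw [h1]; simp
    have h01 : (((γH.1 : unitaryGroup (cmConjRingHom L) (Matrix.of fun i j : Fin 2 => if i.val + j.val + 1 = 2 then (1 : L) else 0)).val : GL (Fin 2) L) :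
        Matrix (Fin 2) (Fin 2) L) 0 1 = 0 := by rw [h1]; simp
    have h10 : (((γH.1 : unitaryGroup (cmConjRingHom L) (Matrix.of fun i j : Fin 2 => if i.val + j.val + 1 = 2 then (1 : L) else 0)).val : GL (Fin 2) L) :
        Matrix (Fin 2) (Fin 2) L) 1 0 = 0 := by rw [h1]; simp
    have h11 : (((γH.1 : unitaryGroup (cmConjRingHom L) (Matrix.of fun i j : Fin 2 => if i.val + j.val + 1 = 2 then (1 : L) else 0)).val : GL (Fin 2) L) :
        Matrix (Fin 2) (Fin 2) L) 1 1 = e₁ := by rw [h1]; simp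
    rw [h00, h01, h10, h11, h2]
    ext i j
    fin_cases i <;> fin_cases j <;> simp
  rw [isNormPair_iff_isConj, isConj_iff]
  refine ⟨Q, Units.ext ?_⟩
  rw [Units.val_mul, Units.val_mul, hι]
  exact hQ.symm

end NormPair

/-! ## §2 The socket `sig_K2E4ExplicitSingularPairNondegenerate`, token for token (frame = ★ p844690's binders, verbatim) -/

section Frame

variable (L : Type) [Field L] [NumberField L] [IsCMField L]

variable (H' : Matrix (Fin 3) (Fin 3) L) (Tinf : ArchTransferFactor L H')
    -- σ-algebras of the `G′` side (★ (O10-c5) block), of `H_v`, `G_∞`, `H_∞`, and the Haar data — EXACTLY ★ `SingularEllipticTransfer`'s binders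
    [∀ g : (UnitaryGroup.cmDatum L 3 H').Adelic, MeasurableSpace ((UnitaryGroup.cmDatum L 3 H').Adelic ⧸ Subgroup.centralizer ({g} : Set (UnitaryGroup.cmDatum L 3 H').Adelic))]
    [∀ g : (UnitaryGroup.cmDatum L 3 H').Adelic, BorelSpace ((UnitaryGroup.cmDatum L 3 H').Adelic ⧸ Subgroup.centralizer ({g} : Set (UnitaryGroup.cmDatum L 3 H').Adelic))]
    [∀ γ : UnitaryGroup.arch (↥(maximalRealSubfield L)) L (IsCMField.complexConj L) 3 H',
      MeasurableSpace (UnitaryGroup.arch (↥(maximalRealSubfield L)) L (IsCMField.complexConj L) 3 H' ⧸ Subgroup.centralizer ({γ} : Set (UnitaryGroup.arch (↥(maximalRealSubfield L)) L (IsCMField.complexConj L) 3 H')))]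
    [∀ γ : UnitaryGroup.arch (↥(maximalRealSubfield L)) L (IsCMField.complexConj L) 3 H',
      BorelSpace (UnitaryGroup.arch (↥(maximalRealSubfield L)) L (IsCMField.complexConj L) 3 H' ⧸ Subgroup.centralizer ({γ} : Set (UnitaryGroup.arch (↥(maximalRealSubfield L)) L (IsCMField.complexConj L) 3 H')))]
    [∀ (v : HeightOneSpectrum (𝓞 ↥(maximalRealSubfield L))) (γ : (UnitaryGroup.cmDatum L 3 H').Local v),
      MeasurableSpace ((UnitaryGroup.cmDatum L 3 H').Local v ⧸ Subgroup.centralizer ({γ} : Set ((UnitaryGroup.cmDatum L 3 H').Local v)))]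
    [∀ (v : HeightOneSpectrum (𝓞 ↥(maximalRealSubfield L))) (γ : (UnitaryGroup.cmDatum L 3 H').Local v),
      BorelSpace ((UnitaryGroup.cmDatum L 3 H').Local v ⧸ Subgroup.centralizer ({γ} : Set ((UnitaryGroup.cmDatum L 3 H').Local v)))]
    [∀ v : HeightOneSpectrum (𝓞 ↥(maximalRealSubfield L)), MeasurableSpace ((UnitaryGroup.cmDatum L 3 H').Local v)] [∀ v : HeightOneSpectrum (𝓞 ↥(maximalRealSubfield L)), BorelSpace ((UnitaryGroup.cmDatum L 3 H').Local v)]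
    [MeasurableSpace (UnitaryGroup.cmDatum L 3 H').Adelic] [BorelSpace (UnitaryGroup.cmDatum L 3 H').Adelic]
    [MeasurableSpace (UnitaryGroup.arch (↥(maximalRealSubfield L)) L (IsCMField.complexConj L) 3 H')] [BorelSpace (UnitaryGroup.arch (↥(maximalRealSubfield L)) L (IsCMField.complexConj L) 3 H')]
    [∀ γ : (UnitaryGroup.cmDatum L 3 H').Adelic, MeasurableSpace (↥(Subgroup.centralizer ({γ} : Set (UnitaryGroup.cmDatum L 3 H').Adelic)) ⧸
      ((UnitaryGroup.cmDatum L 3 H').quotientSubgroup ⊓ Subgroup.centralizer ({γ} : Set (UnitaryGroup.cmDatum L 3 H').Adelic)).subgroupOf (Subgroup.centralizer ({γ} : Set (UnitaryGroup.cmDatum L 3 H').Adelic)))]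
    [∀ γ : (UnitaryGroup.cmDatum L 3 H').Adelic, BorelSpace (↥(Subgroup.centralizer ({γ} : Set (UnitaryGroup.cmDatum L 3 H').Adelic)) ⧸
      ((UnitaryGroup.cmDatum L 3 H').quotientSubgroup ⊓ Subgroup.centralizer ({γ} : Set (UnitaryGroup.cmDatum L 3 H').Adelic)).subgroupOf (Subgroup.centralizer ({γ} : Set (UnitaryGroup.cmDatum L 3 H').Adelic)))]
    [hCcl : ∀ γ : (UnitaryGroup.cmDatum L 3 H').Adelic, IsClosed ((Subgroup.centralizer ({γ} : Set (UnitaryGroup.cmDatum L 3 H').Adelic) : Subgroup (UnitaryGroup.cmDatum L 3 H').Adelic) : Set (UnitaryGroup.cmDatum L 3 H').Adelic)]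
    [∀ γ : (UnitaryGroup.cmDatum L 3 H').Adelic, (count : Measure ↥(((UnitaryGroup.cmDatum L 3 H').quotientSubgroup ⊓ Subgroup.centralizer ({γ} : Set (UnitaryGroup.cmDatum L 3 H').Adelic)).subgroupOf
      (Subgroup.centralizer ({γ} : Set (UnitaryGroup.cmDatum L 3 H').Adelic)))).IsHaarMeasure]
    [∀ v : HeightOneSpectrum (𝓞 ↥(maximalRealSubfield L)), MeasurableSpace ((UnitaryGroup.cmDatum L 2 (Matrix.of fun i j : Fin 2 => if i.val + j.val + 1 = 2 then (1 : L) else 0)).Local v ×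
        (UnitaryGroup.cmDatum L 1 (Matrix.of fun i j : Fin 1 => if i.val + j.val + 1 = 1 then (1 : L) else 0)).Local v)]
    [∀ v : HeightOneSpectrum (𝓞 ↥(maximalRealSubfield L)), BorelSpace ((UnitaryGroup.cmDatum L 2 (Matrix.of fun i j : Fin 2 => if i.val + j.val + 1 = 2 then (1 : L) else 0)).Local v ×
        (UnitaryGroup.cmDatum L 1 (Matrix.of fun i j : Fin 1 => if i.val + j.val + 1 = 1 then (1 : L) else 0)).Local v)]
    [∀ (v : HeightOneSpectrum (𝓞 ↥(maximalRealSubfield L))) (a : ((UnitaryGroup.cmDatum L 2 (Matrix.of fun i j : Fin 2 => if i.val + j.val + 1 = 2 then (1 : L) else 0)).Local v ×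
        (UnitaryGroup.cmDatum L 1 (Matrix.of fun i j : Fin 1 => if i.val + j.val + 1 = 1 then (1 : L) else 0)).Local v)),
      MeasurableSpace (((UnitaryGroup.cmDatum L 2 (Matrix.of fun i j : Fin 2 => if i.val + j.val + 1 = 2 then (1 : L) else 0)).Local v ×
        (UnitaryGroup.cmDatum L 1 (Matrix.of fun i j : Fin 1 => if i.val + j.val + 1 = 1 then (1 : L) else 0)).Local v) ⧸ Subgroup.centralizer ({a} : Set ((UnitaryGroup.cmDatum L 2 (Matrix.of fun i j : Fin 2 => if i.val + j.val + 1 = 2 then (1 : L) else 0)).Local v ×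
        (UnitaryGroup.cmDatum L 1 (Matrix.of fun i j : Fin 1 => if i.val + j.val + 1 = 1 then (1 : L) else 0)).Local v)))]
    [∀ (v : HeightOneSpectrum (𝓞 ↥(maximalRealSubfield L))) (a : ((UnitaryGroup.cmDatum L 2 (Matrix.of fun i j : Fin 2 => if i.val + j.val + 1 = 2 then (1 : L) else 0)).Local v ×
        (UnitaryGroup.cmDatum L 1 (Matrix.of fun i j : Fin 1 => if i.val + j.val + 1 = 1 then (1 : L) else 0)).Local v)),
      BorelSpace (((UnitaryGroup.cmDatum L 2 (Matrix.of fun i j : Fin 2 => if i.val + j.val + 1 = 2 then (1 : L) else 0)).Local v ×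
        (UnitaryGroup.cmDatum L 1 (Matrix.of fun i j : Fin 1 => if i.val + j.val + 1 = 1 then (1 : L) else 0)).Local v) ⧸ Subgroup.centralizer ({a} : Set ((UnitaryGroup.cmDatum L 2 (Matrix.of fun i j : Fin 2 => if i.val + j.val + 1 = 2 then (1 : L) else 0)).Local v ×
        (UnitaryGroup.cmDatum L 1 (Matrix.of fun i j : Fin 1 => if i.val + j.val + 1 = 1 then (1 : L) else 0)).Local v)))]
    [MeasurableSpace (UnitaryGroup.arch (↥(maximalRealSubfield L)) L (IsCMField.complexConj L) 3 (Matrix.of fun i j : Fin 3 => if i.val + j.val + 1 = 3 then (1 : L) else 0))] [BorelSpace (UnitaryGroup.arch (↥(maximalRealSubfield L)) L (IsCMField.complexConj L) 3 (Matrix.of fun i j : Fin 3 => if i.val + j.val + 1 = 3 then (1 : L) else 0))]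
    [∀ γ : UnitaryGroup.arch (↥(maximalRealSubfield L)) L (IsCMField.complexConj L) 3 (Matrix.of fun i j : Fin 3 => if i.val + j.val + 1 = 3 then (1 : L) else 0),
      MeasurableSpace (UnitaryGroup.arch (↥(maximalRealSubfield L)) L (IsCMField.complexConj L) 3 (Matrix.of fun i j : Fin 3 => if i.val + j.val + 1 = 3 then (1 : L) else 0) ⧸ Subgroup.centralizer ({γ} : Set (UnitaryGroup.arch (↥(maximalRealSubfield L)) L (IsCMField.complexConj L) 3 (Matrix.of fun i j : Fin 3 => if i.val + j.val + 1 = 3 then (1 : L) else 0))))]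
    [∀ γ : UnitaryGroup.arch (↥(maximalRealSubfield L)) L (IsCMField.complexConj L) 3 (Matrix.of fun i j : Fin 3 => if i.val + j.val + 1 = 3 then (1 : L) else 0),
      BorelSpace (UnitaryGroup.arch (↥(maximalRealSubfield L)) L (IsCMField.complexConj L) 3 (Matrix.of fun i j : Fin 3 => if i.val + j.val + 1 = 3 then (1 : L) else 0) ⧸ Subgroup.centralizer ({γ} : Set (UnitaryGroup.arch (↥(maximalRealSubfield L)) L (IsCMField.complexConj L) 3 (Matrix.of fun i j : Fin 3 => if i.val + j.val + 1 = 3 then (1 : L) else 0))))]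
    [MeasurableSpace (UnitaryGroup.arch (↥(maximalRealSubfield L)) L (IsCMField.complexConj L) 2 (Matrix.of fun i j : Fin 2 => if i.val + j.val + 1 = 2 then (1 : L) else 0) ×
          UnitaryGroup.arch (↥(maximalRealSubfield L)) L (IsCMField.complexConj L) 1 (Matrix.of fun i j : Fin 1 => if i.val + j.val + 1 = 1 then (1 : L) else 0))]
    [BorelSpace (UnitaryGroup.arch (↥(maximalRealSubfield L)) L (IsCMField.complexConj L) 2 (Matrix.of fun i j : Fin 2 => if i.val + j.val + 1 = 2 then (1 : L) else 0) ×
          UnitaryGroup.arch (↥(maximalRealSubfield L)) L (IsCMField.complexConj L) 1 (Matrix.of fun i j : Fin 1 => if i.val + j.val + 1 = 1 then (1 : L) else 0))]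
    [∀ a : (UnitaryGroup.arch (↥(maximalRealSubfield L)) L (IsCMField.complexConj L) 2 (Matrix.of fun i j : Fin 2 => if i.val + j.val + 1 = 2 then (1 : L) else 0) ×
          UnitaryGroup.arch (↥(maximalRealSubfield L)) L (IsCMField.complexConj L) 1 (Matrix.of fun i j : Fin 1 => if i.val + j.val + 1 = 1 then (1 : L) else 0)),
      MeasurableSpace ((UnitaryGroup.arch (↥(maximalRealSubfield L)) L (IsCMField.complexConj L) 2 (Matrix.of fun i j : Fin 2 => if i.val + j.val + 1 = 2 then (1 : L) else 0) ×
          UnitaryGroup.arch (↥(maximalRealSubfield L)) L (IsCMField.complexConj L) 1 (Matrix.of fun i j : Fin 1 => if i.val + j.val + 1 = 1 then (1 : L) else 0)) ⧸ Subgroup.centralizer ({a} : Set (UnitaryGroup.arch (↥(maximalRealSubfield L)) L (IsCMField.complexConj L) 2 (Matrix.of fun i j : Fin 2 => if i.val + j.val + 1 = 2 then (1 : L) else 0) ×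
          UnitaryGroup.arch (↥(maximalRealSubfield L)) L (IsCMField.complexConj L) 1 (Matrix.of fun i j : Fin 1 => if i.val + j.val + 1 = 1 then (1 : L) else 0))))]
    [∀ a : (UnitaryGroup.arch (↥(maximalRealSubfield L)) L (IsCMField.complexConj L) 2 (Matrix.of fun i j : Fin 2 => if i.val + j.val + 1 = 2 then (1 : L) else 0) ×
          UnitaryGroup.arch (↥(maximalRealSubfield L)) L (IsCMField.complexConj L) 1 (Matrix.of fun i j : Fin 1 => if i.val + j.val + 1 = 1 then (1 : L) else 0)),
      BorelSpace ((UnitaryGroup.arch (↥(maximalRealSubfield L)) L (IsCMField.complexConj L) 2 (Matrix.of fun i j : Fin 2 => if i.val + j.val + 1 = 2 then (1 : L) else 0) ×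
          UnitaryGroup.arch (↥(maximalRealSubfield L)) L (IsCMField.complexConj L) 1 (Matrix.of fun i j : Fin 1 => if i.val + j.val + 1 = 1 then (1 : L) else 0)) ⧸ Subgroup.centralizer ({a} : Set (UnitaryGroup.arch (↥(maximalRealSubfield L)) L (IsCMField.complexConj L) 2 (Matrix.of fun i j : Fin 2 => if i.val + j.val + 1 = 2 then (1 : L) else 0) ×
          UnitaryGroup.arch (↥(maximalRealSubfield L)) L (IsCMField.complexConj L) 1 (Matrix.of fun i j : Fin 1 => if i.val + j.val + 1 = 1 then (1 : L) else 0))))]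
    (νH : ∀ v : HeightOneSpectrum (𝓞 ↥(maximalRealSubfield L)), Measure ((UnitaryGroup.cmDatum L 2 (Matrix.of fun i j : Fin 2 => if i.val + j.val + 1 = 2 then (1 : L) else 0)).Local v ×
        (UnitaryGroup.cmDatum L 1 (Matrix.of fun i j : Fin 1 => if i.val + j.val + 1 = 1 then (1 : L) else 0)).Local v))
    (νG : ∀ v : HeightOneSpectrum (𝓞 ↥(maximalRealSubfield L)), Measure ((UnitaryGroup.cmDatum L 3 H').Local v))
    [∀ v, IsFiniteMeasureOnCompacts (νH v)] [∀ v, (νH v).IsMulRightInvariant]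
    [∀ v, (νG v).IsHaarMeasure] [∀ v, (νG v).IsMulRightInvariant]  -- MAIN-b's strength (F2): `νG_v` Haar
    (νGi : Measure (UnitaryGroup.arch (↥(maximalRealSubfield L)) L (IsCMField.complexConj L) 3 H')) (νqi : Measure (UnitaryGroup.arch (↥(maximalRealSubfield L)) L (IsCMField.complexConj L) 3 (Matrix.of fun i j : Fin 3 => if i.val + j.val + 1 = 3 then (1 : L) else 0)))
    (νHi : Measure (UnitaryGroup.arch (↥(maximalRealSubfield L)) L (IsCMField.complexConj L) 2 (Matrix.of fun i j : Fin 2 => if i.val + j.val + 1 = 2 then (1 : L) else 0) ×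
          UnitaryGroup.arch (↥(maximalRealSubfield L)) L (IsCMField.complexConj L) 1 (Matrix.of fun i j : Fin 1 => if i.val + j.val + 1 = 1 then (1 : L) else 0)))
    [IsFiniteMeasureOnCompacts νGi] [νGi.IsMulRightInvariant] [IsFiniteMeasureOnCompacts νqi] [νqi.IsMulRightInvariant]
    [IsFiniteMeasureOnCompacts νHi] [νHi.IsMulRightInvariant]

-- the five measure-theoretic instance binders of the frame are auto-bound in the socket's type (bytes frozen) but not read by this value computation
set_option linter.unusedSectionVars false in
/-- **Socket #15 `sig_K2E4ExplicitSingularPairNondegenerate` of `Cruxes/H413/Lines/K2_E4_SingularTransferKappaSignSigsSingularProductFormula.lean` (statement bytes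
frozen).**  The explicit factors are NONZERO AT THE SEMIREGULAR PAIR `(γ_H, γ₀)` itself (no junk zero): for the pinned data `Δ = Δ‴`, `Tinf = Δ‴_∞`,
`Δ‴_v((γ_H)_v, (γ₀)_v) ≠ 0` for every finite `v` and `Δ‴_∞(γ_H ⊗ 1, γ₀ ⊗ 1) ≠ 0` — print's `τ(γ)|A₁(γ)A₂(γ)|` with `A₁A₂ ≠ 0` as `e₁ ≠ e₂`.  Proof: the pair
MATCHES (§1 `isNormPair_of_scalarPartner`) and is `(G,H)`-regular (`χ_g(u) = (e₂ − e₁)² ≠ 0`, ★ `eval_charpoly_ne_zero_iff_of_fst_eq_smul_one_rational`); substitute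
the pins (★ `finExplicitCollection_Δ`, ★ `archCanonicalTransferFactor_Δ`, both `rfl`) and apply ★ (P-β) `finExplicitDelta_rationalComponent_ne_zero_of_eval_ne_zero` at
★ `isLocalNormPair_rationalComponent_toLocal_toAdelic`, and ★ (P-γ) `archCanonicalDelta_rationalArch_ne_zero_of_eval_ne_zero`.
[cite: Rogawski1990, §4.9 p. 55; §8.2 Prop. 8.2.1 proof p. 119; §14.6 p. 242] [cite: LanglandsShelstad1987, §1] -/
theorem ExplicitSingularPairNondegenerate :
        ∀ (hK : ∀ v : HeightOneSpectrum (𝓞 ↥(maximalRealSubfield L)), νG v (UnitaryGroup.cmLocalIntegralLevel L 3 H' v : Set ((UnitaryGroup.cmDatum L 3 H').Local v)) = 1)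
          (hanis : ∀ x : Fin 3 → L, hermForm (cmConjRingHom L) H' x x = 0 → x = 0)
          (Sbad : Finset (HeightOneSpectrum (𝓞 ↥(maximalRealSubfield L))))
              (Δ : ∀ v : HeightOneSpectrum (𝓞 ↥(maximalRealSubfield L)), LocalTransferFactor L H' v)
              (mH : ∀ v : HeightOneSpectrum (𝓞 ↥(maximalRealSubfield L)),
                OrbitalMeasureFamily ((UnitaryGroup.cmDatum L 2 (Matrix.of fun i j : Fin 2 => if i.val + j.val + 1 = 2 then (1 : L) else 0)).Local v ×
                  (UnitaryGroup.cmDatum L 1 (Matrix.of fun i j : Fin 1 => if i.val + j.val + 1 = 1 then (1 : L) else 0)).Local v))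
              (mG : ∀ v : HeightOneSpectrum (𝓞 ↥(maximalRealSubfield L)), OrbitalMeasureFamily ((UnitaryGroup.cmDatum L 3 H').Local v))
          (m' : OrbitalMeasureFamily (UnitaryGroup.arch (↥(maximalRealSubfield L)) L (IsCMField.complexConj L) 3 H'))
                (m : OrbitalMeasureFamily (UnitaryGroup.arch (↥(maximalRealSubfield L)) L (IsCMField.complexConj L) 3
                  (Matrix.of fun i j : Fin 3 => if i.val + j.val + 1 = 3 then (1 : L) else 0)))
                (mHi : OrbitalMeasureFamily (UnitaryGroup.arch (↥(maximalRealSubfield L)) L (IsCMField.complexConj L) 2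
                    (Matrix.of fun i j : Fin 2 => if i.val + j.val + 1 = 2 then (1 : L) else 0) ×
                  UnitaryGroup.arch (↥(maximalRealSubfield L)) L (IsCMField.complexConj L) 1
                    (Matrix.of fun i j : Fin 1 => if i.val + j.val + 1 = 1 then (1 : L) else 0)))
                (t' : ∀ γ' : UnitaryGroup.arch (↥(maximalRealSubfield L)) L (IsCMField.complexConj L) 3 H',
                  Measure (Subgroup.centralizer ({γ'} : Set (UnitaryGroup.arch (↥(maximalRealSubfield L)) L (IsCMField.complexConj L) 3 H'))))
                (t : ∀ γ : UnitaryGroup.arch (↥(maximalRealSubfield L)) L (IsCMField.complexConj L) 3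
                    (Matrix.of fun i j : Fin 3 => if i.val + j.val + 1 = 3 then (1 : L) else 0),
                  Measure (Subgroup.centralizer ({γ} : Set (UnitaryGroup.arch (↥(maximalRealSubfield L)) L (IsCMField.complexConj L) 3
                    (Matrix.of fun i j : Fin 3 => if i.val + j.val + 1 = 3 then (1 : L) else 0)))))
                (tH : ∀ γH : UnitaryGroup.arch (↥(maximalRealSubfield L)) L (IsCMField.complexConj L) 2
                      (Matrix.of fun i j : Fin 2 => if i.val + j.val + 1 = 2 then (1 : L) else 0) ×
                    UnitaryGroup.arch (↥(maximalRealSubfield L)) L (IsCMField.complexConj L) 1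
                      (Matrix.of fun i j : Fin 1 => if i.val + j.val + 1 = 1 then (1 : L) else 0),
                  Measure (Subgroup.centralizer ({γH} : Set (UnitaryGroup.arch (↥(maximalRealSubfield L)) L (IsCMField.complexConj L) 2
                      (Matrix.of fun i j : Fin 2 => if i.val + j.val + 1 = 2 then (1 : L) else 0) ×
                    UnitaryGroup.arch (↥(maximalRealSubfield L)) L (IsCMField.complexConj L) 1
                      (Matrix.of fun i j : Fin 1 => if i.val + j.val + 1 = 1 then (1 : L) else 0)))))
            (hherm : (H'.map (cmConjRingHom L)).transpose = H')
            (hCTM : CanonicalTransferMatrix L H' Tinf.Δ νH νG Sbad Δ mH mG)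
            (hACS : ArchCanonicalSingularMatrix L H' Tinf νGi νqi νHi hanis m' m mHi t' t tH),
    ∀ (μ : Literature.NumberTheory.GaloisRepresentations.HeckeCharacter L) (hμu : μ.IsUnitary)
      (hμω : ∀ x : Literature.NumberTheory.GaloisRepresentations.ideleGroup ↥(maximalRealSubfield L),
        μ (AdeleRing.ideleBaseChange (↥(maximalRealSubfield L)) L x) = quadraticHeckeCharCM L x)
      (hΔ : Δ = finExplicitCollection L H' μ (finExplicitDelta_conj_left_all L H' μ) (finExplicitDelta_conj_right_all L H' μ))
      (hTinf : Tinf = archCanonicalTransferFactor L H' μ),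
              ∀ (γ₀ : (UnitaryGroup.cmDatum L 3 H').Rational) (e₁ e₂ : L), e₁ ≠ e₂ →
                ((((γ₀ : unitaryGroup (cmConjRingHom L) H').val : GL (Fin 3) L) : Matrix (Fin 3) (Fin 3) L) - e₁ • (1 : Matrix (Fin 3) (Fin 3) L)) * ((((γ₀ : unitaryGroup (cmConjRingHom L) H').val : GL (Fin 3) L) : Matrix (Fin 3) (Fin 3) L) - e₂ • (1 : Matrix (Fin 3) (Fin 3) L)) = 0 →
                (¬ ∃ ζ : L, (((γ₀ : unitaryGroup (cmConjRingHom L) H').val : GL (Fin 3) L) : Matrix (Fin 3) (Fin 3) L) = ζ • (1 : Matrix (Fin 3) (Fin 3) L)) →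
                (((γ₀ : unitaryGroup (cmConjRingHom L) H').val : GL (Fin 3) L) : Matrix (Fin 3) (Fin 3) L).charpoly =
                  (Polynomial.X - Polynomial.C e₁) ^ 2 * (Polynomial.X - Polynomial.C e₂) →
                ∀ (γH : (UnitaryGroup.cmDatum L 2 (Matrix.of fun i j : Fin 2 => if i.val + j.val + 1 = 2 then (1 : L) else 0)).Rational ×
                    (UnitaryGroup.cmDatum L 1 (Matrix.of fun i j : Fin 1 => if i.val + j.val + 1 = 1 then (1 : L) else 0)).Rational),
                  (((γH.1 : unitaryGroup (cmConjRingHom L) (Matrix.of fun i j : Fin 2 => if i.val + j.val + 1 = 2 then (1 : L) else 0)).val : GL (Fin 2) L) : Matrix (Fin 2) (Fin 2) L) =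
                    e₁ • (1 : Matrix (Fin 2) (Fin 2) L) →
                  (((γH.2 : unitaryGroup (cmConjRingHom L) (Matrix.of fun i j : Fin 1 => if i.val + j.val + 1 = 1 then (1 : L) else 0)).val : GL (Fin 1) L) : Matrix (Fin 1) (Fin 1) L) 0 0 = e₂ →
                  (∀ v : HeightOneSpectrum (𝓞 ↥(maximalRealSubfield L)), (Δ v).Δ ((UnitaryGroup.cmDatum L 2 (Matrix.of fun i j : Fin 2 => if i.val + j.val + 1 = 2 then (1 : L) else 0)).toLocal v ((UnitaryGroup.cmDatum L 2 (Matrix.of fun i j : Fin 2 => if i.val + j.val + 1 = 2 then (1 : L) else 0)).toAdelic γH.1),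
                            (UnitaryGroup.cmDatum L 1 (Matrix.of fun i j : Fin 1 => if i.val + j.val + 1 = 1 then (1 : L) else 0)).toLocal v ((UnitaryGroup.cmDatum L 1 (Matrix.of fun i j : Fin 1 => if i.val + j.val + 1 = 1 then (1 : L) else 0)).toAdelic γH.2)) ((UnitaryGroup.cmDatum L 3 H').toLocal v ((UnitaryGroup.cmDatum L 3 H').toAdelic γ₀)) ≠ 0) ∧ Tinf.Δ (cmRationalToArch L 2 (Matrix.of fun i j : Fin 2 => if i.val + j.val + 1 = 2 then (1 : L) else 0) γH.1, cmRationalToArch L 1 (Matrix.of fun i j : Fin 1 => if i.val + j.val + 1 = 1 then (1 : L) else 0) γH.2) (cmRationalToArch L 3 H' γ₀) ≠ 0 := by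
  intro hK hanis Sbad Δ mH mG m' m mHi t' t tH hherm hCTM hACS μ hμu hμω hΔ hTinf γ₀ e₁ e₂ he hsplit hnc hχ γH h1 h2
  -- (1) the pair matches: `γ_H → γ₀`
  have hnp : IsNormPair L H' γH γ₀ := isNormPair_of_scalarPartner L H' hherm hanis γ₀ he hsplit hnc hχ γH h1 h2
  -- (2) `(G,H)`-regularity: `χ_g(u) = (e₂ − e₁)² ≠ 0`
  have hχg : ((γH.1.val.val : Matrix (Fin 2) (Fin 2) L).charpoly).eval ((γH.2.val.val : Matrix (Fin 1) (Fin 1) L) 0 0) ≠ 0 := by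
    rw [eval_charpoly_ne_zero_iff_of_fst_eq_smul_one_rational L γH h1, h2]
    exact he.symm
  -- (3) substitute the pins and read the two explicit factors at the rational pair
  subst hΔ hTinf
  refine ⟨fun v => ?_, ?_⟩
  · rw [finExplicitCollection_Δ]
    exact finExplicitDelta_rationalComponent_ne_zero_of_eval_ne_zero L H' γH μ hχg v _ (isLocalNormPair_rationalComponent_toLocal_toAdelic hnp v)
  · rw [archCanonicalTransferFactor_Δ, ← archCanonicalDelta_eq_mul]
    exact archCanonicalDelta_rationalArch_ne_zero_of_eval_ne_zero L H' μ γH γ₀ hherm hanis hχg hnp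

end Frame

end Summit.HodgeConjecture.HodgeConjecture.Cruxes.H413.K2E4ExplicitSingularPairNondegenerate

end
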